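import Literature.Topology.FourManifolds.OrientedConnectedSumExistence
import Literature.Topology.FourManifolds.TopologicalConnectedSumAdditivity
import HarnessLib

/-!
# The Kervaire–Milnor identification with a reflected second chart, in complex coordinates

Topic `Literature/Topology/FourManifolds` (fact seat of the Seiberg–Witten leaf
`Literature.Barriers.SmoothPoincare4.akhmedovPark2010_lemma8_invariants`; block 2 of
Akhmedov–Park's `X₁(m)`, A. Akhmedov, B. D. Park, Invent. Math. 181 (2010), §3).  The genus-2
parameter surface `F = T #_D T′` of `Σ̄₂` is the Kervaire–Milnor connected sum
(`ConnectedSumData`, Kervaire–Milnor 1963 §2: `i₁(t u) ∼ i₂((1 - t) u)`) of the parameter tori of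
the two sheets along the surface charts `a = e₁` at the resolved double point and the REFLECTED
chart `e₂ ≫ r`, `r (v₀, v₁) = (v₀, -v₁)` (`sideReflection 1` of
`TopologicalConnectedSumAdditivity.lean`, `ConnectedSumData.reflectRight` of
`OrientedConnectedSumExistence.lean`): in the complex coordinates `a = e₁ p`, `b = e₂ w` the
identification then reads

  `b = (1 - ‖a‖) · conj (a/‖a‖)`,  `0 < ‖a‖ < 1`,

which is EXACTLY the position of the second sheet at the inner end of the resolution neck
(`DoublePointResolutionNeck.lean`: `N (v, ρ) = (v̂ ρ, (1 - ‖v‖) conj v̂)` for `‖v‖ ≤ 1/4`).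

* `sideReflection_one_apply`, `toComplex_sideReflection_one` — `r` is complex conjugation;
* `reflectRight_sideReflection_Φ_iff` — **the gluing map `Φ` of `D.reflectRight r` in complex
  coordinates** (the displayed formula, with the membership conditions);
* `nonempty_smoothOrientation_glued` — the glued surface of ANY connected-sum datum of oriented
  manifolds is orientable (choose the model orientation making `i₁` preserving, and replace the
  orientation of the second summand by its negative if `i₂` happens to preserve it;
  `ConnectedSumData.orientation`).

Everything is proved; no definitions.

## References

* M. Kervaire, J. Milnor, *Groups of homotopy spheres I*, Ann. of Math. 77 (1963), §2. [KervaireMilnor1963]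
* A. Akhmedov, B. D. Park, Invent. Math. 181 (2010) 577–603 = arXiv:math/0701829, §3. [AkhmedovPark2010]
-/

noncomputable section

open scoped Manifold ContDiff Topology ComplexConjugate
open Set Function Complex

namespace Literature.Topology.FourManifolds

/-! ### §1 The side reflection of `ℝ²` is complex conjugation -/

/-- `r (v₀, v₁) = (v₀, -v₁)` for the side reflection of `ℝ²` (reflection in `e₁^⊥`). [folklore] -/
theorem sideReflection_one_apply (v : EuclideanSpace ℝ (Fin 2)) :
    sideReflection 1 v 0 = v 0 ∧ sideReflection 1 v 1 = -(v 1) := by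
  let e₀ : EuclideanSpace ℝ (Fin 2) := EuclideanSpace.single 0 1
  let e₁ : EuclideanSpace ℝ (Fin 2) := EuclideanSpace.single 1 1
  have hv : v = (v 0) • e₀ + (v 1) • e₁ := by
    ext i; fin_cases i <;> simp [e₀, e₁]
  have hax : sideAxis 1 = e₁ := rfl
  have h0 : sideReflection 1 e₀ = e₀ := by
    apply Submodule.reflection_mem_subspace_eq_self
    rw [hax, Submodule.mem_orthogonal_singleton_iff_inner_right]
    simp [e₀, e₁, EuclideanSpace.inner_single_left]
  have h1 : sideReflection 1 e₁ = -e₁ := by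
    show ((ℝ ∙ sideAxis 1)ᗮ).reflection e₁ = -e₁
    rw [hax]
    exact Submodule.reflection_orthogonalComplement_singleton_eq_neg e₁
  have hR : sideReflection 1 v = (v 0) • e₀ - (v 1) • e₁ := by
    conv_lhs => rw [hv]
    rw [map_add, map_smul, map_smul, h0, h1, smul_neg, sub_eq_add_neg]
  rw [hR]
  constructor <;> simp [e₀, e₁]

/-- In complex coordinates the side reflection is conjugation:
`(r v)₀ + i (r v)₁ = conj (v₀ + i v₁)`. [folklore] -/
theorem toComplex_sideReflection_one (v : EuclideanSpace ℝ (Fin 2)) :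
    (⟨sideReflection 1 v 0, sideReflection 1 v 1⟩ : ℂ) = conj (⟨v 0, v 1⟩ : ℂ) := by
  obtain ⟨h0, h1⟩ := sideReflection_one_apply v
  rw [h0, h1]
  apply Complex.ext <;> simp

/-- In complex coordinates the Kervaire–Milnor disc inversion is
`v ↦ ((1 - ‖v‖)/‖v‖) v`. [cite: KervaireMilnor1963, §2] -/
theorem toComplex_discInversionFun (v : EuclideanSpace ℝ (Fin 2)) :
    (⟨discInversionFun v 0, discInversionFun v 1⟩ : ℂ) =
      (((1 - ‖v‖) * ‖v‖⁻¹ : ℝ) : ℂ) * ⟨v 0, v 1⟩ := by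
  show (⟨(((1 - ‖v‖) * ‖v‖⁻¹) • v) 0, (((1 - ‖v‖) * ‖v‖⁻¹) • v) 1⟩ : ℂ) = _
  apply Complex.ext <;> simp

/-- The Euclidean norm of `v ∈ ℝ²` is the modulus of `v₀ + i v₁`. [folklore] -/
theorem norm_eq_norm_toComplex (v : EuclideanSpace ℝ (Fin 2)) : ‖v‖ = ‖(⟨v 0, v 1⟩ : ℂ)‖ := by
  rw [EuclideanSpace.norm_eq, Complex.norm_def, Complex.normSq_apply]
  congr 1
  simp [Fin.sum_univ_two, sq]

/-! ### §2 The gluing map of the reflected datum in complex coordinates -/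

section Glue

variable {M N : Type} [TopologicalSpace M] [ChartedSpace (EuclideanSpace ℝ (Fin 2)) M]
  [TopologicalSpace N] [ChartedSpace (EuclideanSpace ℝ (Fin 2)) N] [IsManifold (𝓡 2) ∞ N]

/-- **The Kervaire–Milnor identification with reflected second chart, in complex coordinates.**
For a connected-sum datum `D = (e₁, e₂)` of surfaces and `D′ = D.reflectRight r`, `r` the side
reflection: `p ∈ D′.Φ.source ∧ D′.Φ p = w` iff `p ∈ e₁.source`, `w ∈ e₂.source`, `0 < ‖a‖ < 1`
and `b = (1 - ‖a‖) conj (a/‖a‖)`, where `a = e₁ p`, `b = e₂ w` as complex numbers.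
[cite: KervaireMilnor1963, §2] [cite: AkhmedovPark2010, §3] -/
theorem reflectRight_sideReflection_Φ_iff (D : ConnectedSumData 2 M N) (p : M) (w : N) :
    (p ∈ (D.reflectRight (sideReflection 1)).Φ.source ∧ (D.reflectRight (sideReflection 1)).Φ p = w) ↔
      (p ∈ D.e₁.source ∧ w ∈ D.e₂.source ∧ 0 < ‖(⟨D.e₁ p 0, D.e₁ p 1⟩ : ℂ)‖ ∧
        ‖(⟨D.e₁ p 0, D.e₁ p 1⟩ : ℂ)‖ < 1 ∧
        (⟨D.e₂ w 0, D.e₂ w 1⟩ : ℂ) = ((1 - ‖(⟨D.e₁ p 0, D.e₁ p 1⟩ : ℂ)‖ : ℝ) : ℂ) *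
          conj (((‖(⟨D.e₁ p 0, D.e₁ p 1⟩ : ℂ)‖⁻¹ : ℝ) : ℂ) * ⟨D.e₁ p 0, D.e₁ p 1⟩)) := by
  set D' := D.reflectRight (sideReflection 1) with hD'
  set a : ℂ := ⟨D.e₁ p 0, D.e₁ p 1⟩ with ha
  have hnorm : ‖D.e₁ p‖ = ‖a‖ := norm_eq_norm_toComplex _
  have he₁ : D'.e₁ = D.e₁ := rfl
  have hsrc : p ∈ D'.Φ.source ↔ p ∈ D.e₁.source ∧ 0 < ‖a‖ ∧ ‖a‖ < 1 := by
    rw [D'.mem_Φ_source, he₁, hnorm]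
  -- `Φ' p = e₂⁻¹ (r (dI (e₁ p)))`
  have hΦ : D'.Φ p = D.e₂.symm (sideReflection 1 (discInversionFun (D.e₁ p))) := by
    rw [D'.Φ_apply, hD', ConnectedSumData.reflectRight_i₂, sideReflection_symm]
    rfl
  -- the complex form of `r (dI (e₁ p))`
  have hcx : (⟨sideReflection 1 (discInversionFun (D.e₁ p)) 0,
      sideReflection 1 (discInversionFun (D.e₁ p)) 1⟩ : ℂ) =
      ((1 - ‖a‖ : ℝ) : ℂ) * conj (((‖a‖⁻¹ : ℝ) : ℂ) * a) := by
    rw [toComplex_sideReflection_one, toComplex_discInversionFun, hnorm, map_mul, map_mul,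
      Complex.conj_ofReal, Complex.conj_ofReal, Complex.ofReal_mul, mul_assoc]
  -- two vectors of `ℝ²` agree iff their complex forms agree
  have hvec : ∀ u u' : EuclideanSpace ℝ (Fin 2), (⟨u 0, u 1⟩ : ℂ) = ⟨u' 0, u' 1⟩ → u = u' := by
    intro u u' h
    have h0 := congrArg Complex.re h
    have h1 := congrArg Complex.im h
    simp only at h0 h1
    ext i; fin_cases i
    · exact h0
    · exact h1
  constructor
  · rintro ⟨hp, hpw⟩
    obtain ⟨hp₁, h0, h1⟩ := hsrc.1 hp
    have hy : sideReflection 1 (discInversionFun (D.e₁ p)) ∈ D.e₂.target := by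
      rw [D.target₂]; exact mem_univ _
    rw [hΦ] at hpw
    refine ⟨hp₁, ?_, h0, h1, ?_⟩
    · rw [← hpw]; exact D.e₂.map_target hy
    · rw [← hpw, D.e₂.right_inv hy, hcx]
  · rintro ⟨hp₁, hw, h0, h1, hb⟩
    refine ⟨hsrc.2 ⟨hp₁, h0, h1⟩, ?_⟩
    rw [hΦ]
    have : D.e₂ w = sideReflection 1 (discInversionFun (D.e₁ p)) := hvec _ _ (by rw [hb, hcx])
    rw [← this, D.e₂.left_inv hw]

end Glue

/-! ### §3 The glued surface of oriented summands is orientable -/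

section Orientation

variable {n : ℕ} {M N : Type} [TopologicalSpace M] [T2Space M]
  [ChartedSpace (EuclideanSpace ℝ (Fin n)) M] [IsManifold (𝓡 n) ∞ M]
  [TopologicalSpace N] [T2Space N] [ChartedSpace (EuclideanSpace ℝ (Fin n)) N] [IsManifold (𝓡 n) ∞ N]

/-- **`M #_D N` of oriented manifolds is orientable, for every connected-sum datum `D`**: take the
model orientation `o₀` for which `i₁` preserves orientation (`exists_isOrientationPreserving_disc`);
`i₂` then preserves or reverses `o₀ ↦ oN` (`isOrientationPreserving_or_isOrientationReversing_disc`),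
and in the first case it reverses `o₀ ↦ -oN`; glue with `ConnectedSumData.orientation`.
[cite: KervaireMilnor1963, §2] -/
theorem nonempty_smoothOrientation_glued (hn : n ≠ 0) (D : ConnectedSumData n M N)
    (oM : SmoothOrientation (𝓡 n) M) (oN : SmoothOrientation (𝓡 n) N) :
    Nonempty (SmoothOrientation (𝓡 n) (D.Glued hn)) := by
  obtain ⟨o₀, h₁⟩ := exists_isOrientationPreserving_disc D.isSmoothEmbedding_i₁ D.isOpen_range_i₁ oM
  rcases isOrientationPreserving_or_isOrientationReversing_disc D.isSmoothEmbedding_i₂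
    D.isOpen_range_i₂ o₀ oN with h₂ | h₂
  · refine ⟨D.orientation hn oM (-oN) o₀ h₁ ?_⟩
    rw [isOrientationReversing_iff, neg_neg]
    exact h₂
  · exact ⟨D.orientation hn oM oN o₀ h₁ h₂⟩

end Orientation

end Literature.Topology.FourManifolds
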